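import Literature.AlgebraicGeometry.ShimuraVarieties.KudlaRapoport2013.Sec13LevelStructures
import Literature.AlgebraicGeometry.ShimuraVarieties.KudlaRapoportYang2006.Ch3CyclesShimuraCurvesI
import Literature.NumberTheory.EllipticCurves.KugaSatoVariety
import Mathlib.RingTheory.DedekindDomain.Different
import Mathlib.RingTheory.Valuation.ValuationSubring
import Mathlib.Algebra.Category.AlgCat.Basic
import HarnessLib

/-!
# Kudla–Rapoport, *Special cycles on unitary Shimura varieties II: global theory*, §14 «The case `n = 2`»
# (arXiv v2 pp. 51–58) — SECTION CARPET (statements only, no proof)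

[KudlaRapoport2013] = S. Kudla, M. Rapoport, *Special cycles on unitary Shimura varieties II: global theory*, J. reine
angew. Math. **697** (2014) 91–157 = arXiv:0912.3758.  VERSION OF RECORD (squad ruling R-1): arXiv **v2** (18 Dec 2012),
cited «(arXiv v2 p. N)», read on the squad's v2 page text (`T/KR/TKR-t02/g0/KR2013-arXivv2-pages.txt`, sha16
5ca9342435eb98df) with formulas from the held v1 TeX (`paper:arxiv-0912.3758`, chunks p0036–p0040).  CONCORDANCE v1 ↔ v2
for §14: Lem. 14.1, Lem. 14.2, Rem. 14.3, Prop. 14.4, Prop. 14.5, Lem. 14.6, Prop. 14.7 carry the same numbers; v1's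
un-numbered interpretation paragraph and «Proposition 14.8 ∕ Remark 14.9» became v2's **Remark 14.8, Corollary 14.9,
Proposition 14.10, Remark 14.11** (v1 pp. 65–72, v2 pp. 51–58); displays (14.1)–(14.6) are v2's.

## What this file is

The squad-TKR carpet of §14 (deal sheet `SPLIT-TKR.v1` row TKR-t03, second block after ruling R-1 dropped v1's §15), on
the §3/§13 carpets (`Sec3ComplexUniformization`: `krForm`, `LatticeDatum`, `IsHermitianFor`, `HasSignatureAt`,
`IsFullLattice`, `IsSelfDualFor`, ★ `formCongr`; `Sec13LevelStructures`: `absDisc` = `|Δ|`) and the squad's KRY carpet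
★ `KudlaRapoportYang2006.Ch3CyclesShimuraCurvesI` (quaternion algebras over `ℚ`: `IsIndefinite B`, `disc B` = `D(B)`, over ★
`IsQuaternionAlgebra ℚ B`).  §14 specialises §§2–13 to `n = 2`: the moduli stack `M(1,1)*` over `Spec ℤ`, the functors
`j_𝔞 : 𝓔 → M^{spl}(1,1)*` from the moduli stack of elliptic curves (Serre construction `E ↦ 𝔞 ⊗_ℤ E`), the special cycles
`Z*(m)`, Hecke correspondences `T(m)`, `Γ₀(N)`-structures and Heegner points.  Typed here: (i) the ARITHMETIC over REAL
objects — the antilinear isomorphism `𝔡⁻¹𝔞 ⥲ 𝔞^∨` of p. 51 (Mathlib `FractionalIdeal.dual`, `Algebra.trace`), the hermitian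
spaces `V^B` and **Lemma 14.1** (CLOSED), the `π^i`-modular dyadic lattices of **Lemma 14.2** / **Remark 14.3** (REAL
statement on the consumer's model `(K, O, σ, π)` of `(k₂, O_{k,2}, σ, π)` via Mathlib `ValuationSubring`); (ii) the GEOMETRIC
statements **Prop. 14.4, 14.5, 14.7, 14.10, Lemma 14.6** as PREDICATES on ⟨CARRIER⟩ data for the stacks `M^{spl}(1,1)*`,
`Z*(m)`, `T(m)`, `𝓔₀(N)`, … (the moduli problems are conditions on the §2 object carriers of the squad's `Sec2Defs`; the
elliptic curves are REAL: ★ `EllipticCurves.EllCurveOver S`, the ideal classes REAL: Mathlib `ClassGroup (𝓞 k)`); where both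
sides of a printed isomorphism are carriers the typed row is the SHAPE of the statement (declared «SHAPE» below; not a fact).
Dedup census (2026-09-02): no tree declaration carries a `[cite: KudlaRapoport2013, §14 …]` tag.

Every `def … : Prop` named `KR2013_14_…` is either CLOSED (true as written) or a PREDICATE on consumer data; `∀ D, P D` is
never claimed.  NO PROOF, no `sorry`, no `axiom`, no `instance`, no `notation`.

## INDEX — every item of §14 ↦ declaration

* p. 51 (set-up): the Serre construction `M ⊗_ℤ E`, `(M ⊗ E)^∨ ≅ M^∨ ⊗ E^∨`, the `(1,1)`-signature condition
  `char(T, ι(a) ∣ Lie A) = T² − tr(a)T + N(a)` ↦ RECORDED (the identity `(T−a)(T−a^σ) = T² − tr(a)T + N(a)`; the Serre tensor is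
  the tree's ★ `AbelianSchemeOver.serreTensor`, not restated); «an `O_k`-antilinear isomorphism `𝔡⁻¹𝔞 ⥲ 𝔞^∨`,
  `a ↦ N(𝔞)⁻¹ (·, a)_k`, `(x, y)_k = tr(x y^σ)`» ↦ `KR2013_14_dualIso` (CLOSED); «`λ` … has degree `|Δ|`», the functor `j_𝔞` (14.1),
  the stack `M(1,1)*` («`ker(λ) = A[𝔡]`»; «if `Δ` is odd … corresponds to `t(p) = 2` for all `p ∣ Δ`»), the decomposition
  `M(1,1)* = ∐_V M^V(1,1)*` ↦ ⟨CARRIER⟩ `Sec14Geometry` (objects and `j_𝔞` on the consumer's `S`-points) — RECORDED clauses quoted there.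
* p. 52: `B = k ⊕ B_−`, `V = V^B = B` with `(x, y) = (x y^ι)_+`, `D(B)` ↦ `IsAntiCommuting`, `quatGram` (the Gram matrix `⟨1, −b⟩` of
  `V^B` in the basis `1, j`, `j ∈ B_−`, `j² = b`); **Lemma 14.1** ↦ `KR2013_14_1` (CLOSED: (i) every `V^B`, `B` indefinite with
  `D(B) ∣ Δ`, is relevant of signature `(1,1)`; (ii) every relevant `V` of signature `(1,1)` is `≅ V^B` for such a `B`); «`M₂(ℚ)` always
  occurs … `V^{spl} := V^{M₂(ℚ)}`» ↦ `splitGram`; **Lemma 14.2** ↦ `IsPiModular`, `dyadicRepsIso`, `dyadicRepsAniso`, `KR2013_14_2`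
  (predicate on the consumer's dyadic datum `(K, O, σ, π)`); **Remark 14.3** ↦ `IsTypeIIGram`; p. 53 «for `p ∣ Δ`, `p ≠ 2` … a unique
  isometry class of `π_p`-modular hermitian lattices of rank 2», `𝓡_{(1,1)}(k)*`, «fibers of cardinality 1 or 2», the decomposition
  `M(1,1)*[½] = ∐_{V*} M^{V*}(1,1)*[½]` ↦ RECORDED (local statements on carriers of the same kind; no new arithmetic beyond Lem. 14.2).
* p. 53: **Proposition 14.4** ↦ `KR2013_14_4` (predicate: `∐_{[𝔞] ∈ C(k)} j_𝔞 : ∐ 𝓔 → M^{spl}(1,1)*` is an equivalence on `S`-points,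
  REAL source `ClassGroup (𝓞 k) × EllCurveOver S`; (iii) with `2` invertible on `S` and the type-II locus).
* p. 54: `Z*(m)`, `T(m)`, `s`, `t`, `i₀`, `t_𝔞`, `i_𝔞`, `T(m)_{Δ,𝔞}` ↦ ⟨CARRIER⟩ `HeckeData` (REAL `s, t : T(m) → 𝓔`); **Proposition 14.5**
  ↦ `KR2013_14_5` (SHAPE: fibrewise bijection over `𝓔 × M₀`); **Lemma 14.6** ↦ `KR2013_14_6` (SHAPE on ⟨CARRIER⟩ `SerreAdjData`:
  `h(y, y) = y ∘ y* = deg(y₀)` under (14.2)).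
* pp. 55–56: `𝓔₀(N)`, `j_{𝔞,N}`, `M^{spl}(1,1)*₀(N)`, `Z**(m)`, `T(m)₀(N)`, `i_{0,𝔫}`, `i_{𝔞,𝔫}` ↦ ⟨CARRIER⟩ `LevelHeckeData`; the hypothesis
  «all primes dividing `N` split in `k` … an integral ideal `𝔫` with `N(𝔫) = N`» ↦ `IsHeegnerLevel` (REAL); **Proposition 14.7** ↦
  `KR2013_14_7` (SHAPE); **Remark 14.8** (graph of `i_{𝔞,𝔫}`, coarse moduli `Spec(O_H[N⁻¹]) → 𝓔₀(N)`, (14.5) `Spec H → X₀(N)`) and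
  **Corollary 14.9** (= the Heegner points of [GrossZagier] p. 227 and their Hecke images) ↦ RECORDED: identifications with the
  objects of [KR's ref. 14] = Gross–Zagier, whose Heegner points live in the tree's `EllipticCurves/HeegnerPoints*` files under a
  different presentation — no faithful equation can be typed without the Serre-construction functor on coarse moduli schemes.
* p. 57: the Shimura-curve variant (`M^B`, `j^B`, `j^B_𝔞`, (14.6)) ↦ RECORDED; **Proposition 14.10** ↦ `KR2013_14_10` (predicate on
  ⟨CARRIER⟩ `DegenerationData`: étale Galois double cover `M(t;1,1)*,p → M(t;1,1)*` and proper `φ` finite of degree `p+1` off `p` —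
  PLACEHOLDER fields); **Remark 14.11** ↦ RECORDED (Dieudonné-module description of the positive-dimensional fibres; EGA IV 18.10.16).

## References

* [KudlaRapoport2013] S. Kudla, M. Rapoport, *Special cycles on unitary Shimura varieties II: global theory*, J. reine
  angew. Math. 697 (2014) 91–157; arXiv:0912.3758v2, §14 pp. 51–58.
* [GrossZagier1986] B. Gross, D. Zagier, *Heegner points and derivatives of L-series*, Invent. Math. 84 (1986) — KR's [14]
  (p. 227 Heegner points, p. 313 Shimura curves).
* [KudlaRapoportYang2006] S. Kudla, M. Rapoport, T. Yang, *Modular forms and special cycles on Shimura curves*, AM-161 (2006),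
  Ch. 3 §3.1 (the tree's `D(B)`, indefiniteness).
* [KatzMazur1985] N. Katz, B. Mazur, *Arithmetic moduli of elliptic curves* (1985), (2.1.1) (the tree's `EllCurveOver`).
-/

noncomputable section

open NumberField CategoryTheory Matrix AlgebraicGeometry
open scoped nonZeroDivisors

namespace Literature.AlgebraicGeometry.ShimuraVarieties.KudlaRapoport2013.Sec14CaseNTwo

open Literature.NumberTheory.Automorphic (unitaryGroupOfForm formCongr IsQuaternionAlgebra)
open Literature.NumberTheory.Automorphic.Liu2021.AppendixC (conj)
open Literature.AlgebraicGeometry.ShimuraVarieties.KudlaRapoport2013.Sec3ComplexUniformization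
open Literature.AlgebraicGeometry.ShimuraVarieties.KudlaRapoport2013.Sec13LevelStructures (absDisc)
open Literature.AlgebraicGeometry.ShimuraVarieties.KudlaRapoportYang2006.Ch3CyclesShimuraCurvesI (IsIndefinite disc)
open Literature.NumberTheory.EllipticCurves (EllCurveOver)

universe u v

/-! ## p. 51: the trace dual of a fractional ideal -/

/-- **[KR2013 §14, p. 51] CLOSED**: «Note that there is an `O_k`-antilinear isomorphism `𝔡⁻¹𝔞 ⥲ 𝔞^∨`, `a ↦ N(𝔞)⁻¹ (·, a)_k`,
where `(x, y)_k = tr(x y^σ)` is the trace form of `k/ℚ`, and `𝔡⁻¹` is the inverse different» (`𝔞^∨ = Hom_ℤ(𝔞, ℤ)` with its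
natural `O_k`-action).  TYPED for an invertible fractional ideal `𝔞` of the imaginary-quadratic field `k` (`𝔡⁻¹` = Mathlib
`FractionalIdeal.dual ℤ ℚ 1`, `N` = `FractionalIdeal.absNorm`, `tr` = `Algebra.trace ℚ k`, `σ = conj ℚ k`): (i) for `a ∈ 𝔡⁻¹𝔞` the
functional `x ↦ N(𝔞)⁻¹ tr(x a^σ)` is `ℤ`-valued on `𝔞`; (ii) every `ℤ`-linear `f : 𝔞 → ℤ` is of this form for a unique `a ∈ 𝔡⁻¹𝔞`
(bijectivity; antilinearity is the visible formula). [cite: KudlaRapoport2013, §14 (arXiv v2 p. 51)] -/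
def KR2013_14_dualIso : Prop :=
  ∀ (k : Type) [Field k] [NumberField k] [IsTotallyComplex k] [Algebra.IsQuadraticExtension ℚ k]
    (𝔞 : (FractionalIdeal (𝓞 k)⁰ k)ˣ),
    let dinv𝔞 : FractionalIdeal (𝓞 k)⁰ k := FractionalIdeal.dual ℤ ℚ (1 : FractionalIdeal (𝓞 k)⁰ k) * (𝔞 : FractionalIdeal (𝓞 k)⁰ k)
    let N : ℚ := FractionalIdeal.absNorm (𝔞 : FractionalIdeal (𝓞 k)⁰ k)
    (∀ a : k, a ∈ dinv𝔞 → ∀ x : k, x ∈ (𝔞 : FractionalIdeal (𝓞 k)⁰ k) →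
        ∃ m : ℤ, N⁻¹ * Algebra.trace ℚ k (x * conj ℚ k a) = m) ∧
    (∀ f : (𝔞 : FractionalIdeal (𝓞 k)⁰ k) →ₗ[ℤ] ℤ,
        ∃! a : k, a ∈ dinv𝔞 ∧ ∀ x : (𝔞 : FractionalIdeal (𝓞 k)⁰ k),
          ((f x : ℤ) : ℚ) = N⁻¹ * Algebra.trace ℚ k ((x : k) * conj ℚ k a))

/-! ## p. 52: the hermitian spaces `V^B` and Lemma 14.1 -/

section Quaternion

variable {k : Type} [Field k] [NumberField k] [IsTotallyComplex k] [Algebra.IsQuadraticExtension ℚ k]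

/-- «`B_−` is the set of `b ∈ B` such that `b a = a^σ b` for all `a ∈ k`» (p. 52), for a quaternion algebra `B/ℚ` with an
embedding `e : k → B`. [cite: KudlaRapoport2013, §14 (arXiv v2 p. 52)] -/
def IsAntiCommuting {B : Type} [Ring B] [Algebra ℚ B] (e : k →ₐ[ℚ] B) (j : B) : Prop :=
  ∀ a : k, j * e a = e (conj ℚ k a) * j

/-- **The Gram matrix of `V^B`** in the `k`-basis `1, j` of `B = k ⊕ B_−` (`j ∈ B_−`, `j² = b ∈ ℚ^×`): «the space `V = V^B = B`,
viewed as a left vector space over `k`, has a hermitian form `(x, y) = (x y^ι)_+`, where `b ↦ b^ι` is the main involution of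
`B`, and where for `x ∈ B`, we denote by `x_+ ∈ k` its component in the above direct sum decomposition» (p. 52).  For
`x = x₁ + x₂ j`, `y = y₁ + y₂ j` one computes `(x y^ι)_+ = x₁ y₁^σ − b x₂ y₂^σ`, i.e. `V^B = ⟨1, −b⟩` in the convention `krForm`
(READING R0 of the §3 file; the computation `(x₁ + x₂ j)(y₁^σ − y₂ j) = (x₁y₁^σ − b x₂ y₂^σ) + (x₂ y₁ − x₁ y₂) j` uses `j a = a^σ j`,
`j^ι = −j`). [cite: KudlaRapoport2013, §14 (arXiv v2 p. 52)] -/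
def quatGram (b : ℚ) : Matrix (Fin 2) (Fin 2) k :=
  !![1, 0; 0, -algebraMap ℚ k b]

/-- **`V^{spl} := V^{M₂(ℚ)}`, «the split hermitian space»** (p. 52): `M₂(ℚ) = (k, σ, 1)` (`j² = 1`), so `V^{spl} = ⟨1, −1⟩`.
[cite: KudlaRapoport2013, §14 (arXiv v2 p. 52)] -/
def splitGram : Matrix (Fin 2) (Fin 2) k := quatGram 1

end Quaternion

/-- **[KR2013, Lemma 14.1] CLOSED** (§14, arXiv v2 p. 52): «`𝓡_{(1,1)}(k) = {[V^B] ∣ B indefinite, D(B) ∣ Δ}`.»  (With p. 52: `V^B = B`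
as a left `k`-space, `(x, y) = (x y^ι)_+`; `D(B)` the product of the primes at which `B` is a division algebra = ★ `disc B`;
`𝓡_{(1,1)}(k)` = isomorphism classes of relevant hermitian spaces of signature `(1,1)`, §2.4.)  TYPED in coordinates (`V^B = ⟨1, −b⟩`
for `j ∈ B_−`, `j² = b`, `quatGram`): for every complex embedding `τ` of the imaginary-quadratic `k`,
(i) for every quaternion algebra `B/ℚ` (★ `IsQuaternionAlgebra ℚ B`) containing `k` (`e : k → B`), indefinite with `D(B) ∣ Δ`, and every
`j ∈ B_−`, `j ≠ 0`, `j² = b ∈ ℚ`, the space `⟨1, −b⟩` is hermitian of signature `(1,1)` at `τ` and relevant (contains a self-dual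
`O_k`-lattice); (ii) conversely every hermitian `J ∈ M₂(k)` of signature `(1,1)` at `τ` admitting a self-dual `O_k`-lattice is isometric
to such a `V^B` (the quaternion algebra packaged as an object of Mathlib's `AlgCat ℚ`). [cite: KudlaRapoport2013, §14 Lem. 14.1 (arXiv v2 p. 52)] -/
def KR2013_14_1 : Prop :=
  ∀ (k : Type) [Field k] [NumberField k] [IsTotallyComplex k] [Algebra.IsQuadraticExtension ℚ k] (τ : k →+* ℂ),
    (∀ (B : Type) [Ring B] [Algebra ℚ B] [IsQuaternionAlgebra ℚ B] (e : k →ₐ[ℚ] B) (j : B) (b : ℚ),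
        IsIndefinite B → disc B ∣ absDisc k → j ≠ 0 → IsAntiCommuting e j → j * j = algebraMap ℚ B b →
        IsHermitianFor (conj ℚ k : k →+* k) (quatGram (k := k) b) ∧ HasSignatureAt τ (quatGram (k := k) b) 1 ∧
          ∃ L : Submodule (𝓞 k) (Fin 2 → k), IsFullLattice L ∧ IsSelfDualFor (conj ℚ k : k →+* k) (quatGram b) L) ∧
    (∀ J : Matrix (Fin 2) (Fin 2) k, IsHermitianFor (conj ℚ k : k →+* k) J → HasSignatureAt τ J 1 →
        (∃ L : Submodule (𝓞 k) (Fin 2 → k), IsFullLattice L ∧ IsSelfDualFor (conj ℚ k : k →+* k) J L) →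
        ∃ (B : AlgCat.{0} ℚ) (e : k →ₐ[ℚ] B) (j : B) (b : ℚ) (g : GL (Fin 2) k),
          IsQuaternionAlgebra ℚ B ∧ IsIndefinite B ∧ disc B ∣ absDisc k ∧ j ≠ 0 ∧ IsAntiCommuting e j ∧
            j * j = algebraMap ℚ B b ∧ formCongr (conj ℚ k : k →+* k) g (quatGram b) = J)

/-! ## pp. 52–53: Lemma 14.2 and Remark 14.3 — `π^i`-modular dyadic lattices of rank `2` -/

section Dyadic

variable {K : Type} [Field K]

/-- The dual `L^∨ = {x ∈ V₂ ∣ (x, L) ⊆ O}` of an `O`-lattice `L ⊆ V₂ = K²` for the hermitian Gram matrix `J` (involution `σ₂` of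
`K`), as a set (Lemma 14.2: «`π^i`-modular, i.e., `L^∨ = π^{−i} L` as lattices in `V₂ = L ⊗_{ℤ₂} ℚ₂`»), on the consumer's model
`(K, O, σ₂)` of `(k₂, O_{k,2}, σ)` (Mathlib `ValuationSubring`). [cite: KudlaRapoport2013, §14 Lem. 14.2 (arXiv v2 p. 52)] -/
def dualSetLoc (O : ValuationSubring K) (σ₂ : K →+* K) (J : Matrix (Fin 2) (Fin 2) K) (L : Submodule O (Fin 2 → K)) :
    Set (Fin 2 → K) :=
  {x | ∀ y ∈ L, krForm σ₂ J x y ∈ O}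

/-- **«`L` is `π^i`-modular, i.e., `L^∨ = π^{−i} L`»** (Lemma 14.2, p. 52): `x ∈ L^∨ ↔ π^i x ∈ L`, for a full `O`-lattice `L ⊆ K²`
(finitely generated, spanning). [cite: KudlaRapoport2013, §14 Lem. 14.2 (arXiv v2 p. 52)] -/
def IsPiModular (O : ValuationSubring K) (σ₂ : K →+* K) (π : K) (i : ℕ) (J : Matrix (Fin 2) (Fin 2) K)
    (L : Submodule O (Fin 2 → K)) : Prop :=
  L.FG ∧ Submodule.span K (L : Set (Fin 2 → K)) = ⊤ ∧ ∀ x : Fin 2 → K, x ∈ dualSetLoc O σ₂ J L ↔ π ^ i • x ∈ L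

/-- The standard lattice `O² ⊆ K²`. [cite: KudlaRapoport2013, §14 Lem. 14.2 (arXiv v2 p. 52)] -/
def stdLatticeLoc (O : ValuationSubring K) : Submodule O (Fin 2 → K) :=
  Submodule.span O (Set.range fun i : Fin 2 => (Pi.single i 1 : Fin 2 → K))

/-- **The representatives of Lemma 14.2 (a)** (`V₂` isotropic; p. 52): for `i = 2`, «`2·( 0 1 ; 1 0 )`, `2·( 1 0 ; 0 −1 )`»; for `i = 3`,
«`2·( 0 π ; π^σ 0 )`, `2·( 2 π ; π^σ 0 )`»; for other `i` none (when `2` ramifies, `i = ord₂(Δ) ∈ {2, 3}`).  Listed with the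
TYPE II representative first (Remark 14.3). [cite: KudlaRapoport2013, §14 Lem. 14.2 (arXiv v2 p. 52)] -/
def dyadicRepsIso (σ₂ : K →+* K) (π : K) (i : ℕ) : List (Matrix (Fin 2) (Fin 2) K) :=
  if i = 2 then [(2 : K) • !![0, 1; 1, 0], (2 : K) • !![1, 0; 0, -1]]
  else if i = 3 then [(2 : K) • !![0, π; σ₂ π, 0], (2 : K) • !![2, π; σ₂ π, 0]]
  else []

/-- **The representatives of Lemma 14.2 (b)** (`V₂` anisotropic; p. 52): for `i = 2`, «`2·( 1 0 ; 0 −1 )`»; for `i = 3`,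
«`2·( 2 π ; π^σ 4 )`». [cite: KudlaRapoport2013, §14 Lem. 14.2 (arXiv v2 p. 52)] -/
def dyadicRepsAniso (σ₂ : K →+* K) (π : K) (i : ℕ) : List (Matrix (Fin 2) (Fin 2) K) :=
  if i = 2 then [(2 : K) • !![1, 0; 0, -1]]
  else if i = 3 then [(2 : K) • !![2, π; σ₂ π, 4]]
  else []

/-- **[KR2013, Remark 14.3]** (p. 52): «We will refer to the first of the two lattices in each line of the lists in case (a) as `type II'
lattices.»  TYPED: the Gram matrix `G` is the type-II representative for `i`, i.e. the head of `dyadicRepsIso σ₂ π i`.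
[cite: KudlaRapoport2013, §14 Rem. 14.3 (arXiv v2 p. 52)] -/
def IsTypeIIGram (σ₂ : K →+* K) (π : K) (i : ℕ) (G : Matrix (Fin 2) (Fin 2) K) : Prop :=
  (dyadicRepsIso σ₂ π i).head? = some G

/-- `g ∈ GL₂(K)` is an isometry of hermitian lattices `(J, L) → (G, O²)` over the local datum: `σ₂(g)ᵀ G g = J` and `g L = O²`.
[cite: KudlaRapoport2013, §14 Lem. 14.2 (arXiv v2 p. 52)] -/
def IsIsometryToStd (O : ValuationSubring K) (σ₂ : K →+* K) (J G : Matrix (Fin 2) (Fin 2) K) (L : Submodule O (Fin 2 → K))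
    (g : GL (Fin 2) K) : Prop :=
  formCongr σ₂ g G = J ∧ stdLatticeLoc O = L.map ((Matrix.toLin' (g : Matrix (Fin 2) (Fin 2) K)).restrictScalars O)

/-- **[KR2013, Lemma 14.2] AS PRINTED** (§14, arXiv v2 p. 52), on the consumer's datum `(K, O, σ₂, π, i)` for «`O_{k,2}`» (`K = k₂ = k ⊗ ℚ₂`,
a field since `2` ramifies; `O = O_{k,2}` its valuation ring; `σ₂` the extension of `σ`; `π` a uniformizer; `i = ord₂(Δ)`) — the
identification of the datum with the completion of `k` is the datum's MEANING (as for every consumer-supplied model), the statement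
itself is REAL: «Let `L` be an `O_{k,2}`-lattice of rank `2` that is `π^i`-modular, i.e., `L^∨ = π^{−i}L` as lattices in
`V₂ = L ⊗_{ℤ₂} ℚ₂`, where `i = ord₂(Δ)`. (a) Suppose that `V₂` is isotropic. Then representatives for the isometry types of
`π^i`-modular lattices are given by `2( 0 1 ; 1 0 )`, `2( 1 0 ; 0 −1 )` for `i = 2`, and `2( 0 π ; π^σ 0 )`, `2( 2 π ; π^σ 0 )`, for `i = 3`.
(b) Suppose that `V₂` is anisotropic. Then representatives for the isometry types of `π^i`-modular lattices are given by
`2( 1 0 ; 0 −1 )`, for `i = 2`, and `2( 2 π ; π^σ 4 )`, for `i = 3`.»  TYPED: for `J` hermitian (w.r.t. `σ₂`) and `L` a `π^i`-modular full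
`O`-lattice in `(K², J)`, with `V₂` isotropic (resp. anisotropic), there is EXACTLY ONE Gram matrix `G` in the list (a) (resp. (b)) for
`i` with `(J, L) ≅ (G, O²)`.  A consumer takes `(h : KR2013_14_2 O σ₂ π i)` for its own model. NO PROOF.
[cite: KudlaRapoport2013, §14 Lem. 14.2 (arXiv v2 p. 52)] -/
def KR2013_14_2 (O : ValuationSubring K) (σ₂ : K →+* K) (π : K) (i : ℕ) : Prop :=
  ∀ (J : Matrix (Fin 2) (Fin 2) K) (L : Submodule O (Fin 2 → K)), IsHermitianFor σ₂ J → IsPiModular O σ₂ π i J L →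
    ((∃ x : Fin 2 → K, x ≠ 0 ∧ krForm σ₂ J x x = 0) →
        ∃! G : Matrix (Fin 2) (Fin 2) K, G ∈ dyadicRepsIso σ₂ π i ∧ ∃ g : GL (Fin 2) K, IsIsometryToStd O σ₂ J G L g) ∧
    ((∀ x : Fin 2 → K, krForm σ₂ J x x = 0 → x = 0) →
        ∃! G : Matrix (Fin 2) (Fin 2) K, G ∈ dyadicRepsAniso σ₂ π i ∧ ∃ g : GL (Fin 2) K, IsIsometryToStd O σ₂ J G L g)

end Dyadic

/-! ## pp. 51–53: the stacks `𝓔`, `M^{spl}(1,1)*` on `S`-points and Proposition 14.4 -/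

section Geometry

variable {k : Type} [Field k] [NumberField k] [IsTotallyComplex k] [Algebra.IsQuadraticExtension ℚ k]
variable {S : Scheme.{u}}

/-- An isomorphism of elliptic curves over `S` (a morphism of the moduli stack `𝓔`, p. 51: «Let `𝓔` be the moduli stack of
elliptic curves over `Spec ℤ`»): an isomorphism of the total spaces over `S` preserving the zero sections (★ `EllCurveOver`,
Katz–Mazur (2.1.1)); it is then automatically a homomorphism of `S`-group schemes. [cite: KudlaRapoport2013, §14 (arXiv v2 p. 51)] -/
def EllIso (E E' : EllCurveOver S) : Type u :=
  {e : E.E ≅ E'.E // MonObj.one (X := E.E) ≫ e.hom = MonObj.one (X := E'.E)}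

/-- ⟨CARRIER⟩ **The `S`-points of `M^{spl}(1,1)*` and the functors `j_𝔞`** (pp. 51–53), for the consumer's `O_k`-scheme `S` and
groupoid `Mspl = M^{spl}(1,1)*(S)` (objects `(A, ι, λ)`: «`A` is an abelian scheme over `S`, `ι` is an action of `O_k` on `A`
satisfying the `(1,1)`-signature condition, and `λ : A → A^∨` is a polarization with corresponding Rosati involution satisfying
`ι(a)* = ι(a^σ)`. Finally, we require that `ker(λ) = A[𝔡]`», in the summand `M^{V^{spl}}(1,1)*` of `M(1,1)* = ∐_V M^V(1,1)*`, p. 52 —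
conditions on the squad's `Sec2Defs` object carriers): `jObj 𝔞 E` = «`j_𝔞 : 𝓔 → M^{spl}(1,1)*`, `E ↦ (𝔞 ⊗_ℤ E, ι, λ)`» (14.1) on objects
(REAL arguments: `[𝔞] ∈ C(k)` = Mathlib `ClassGroup (𝓞 k)`, `E` = ★ `EllCurveOver S`; Prop. 14.4 (i) «the morphism `j_𝔞` has image
contained in `M^{spl}(1,1)*`» is this typing), `jMap` on isomorphisms with its functoriality laws, and the ⟨CARRIER⟩ predicate
`IsTypeII` («the locus … where the `2`-adic Tate module has type II», Prop. 14.4 (iii)).  The dependence of `j_𝔞` on the class `[𝔞]`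
only (up to isomorphism of functors) is built in by indexing with `ClassGroup`.  Nothing is asserted. [cite: KudlaRapoport2013, §14 (14.1) (arXiv v2 pp. 51–53)] -/
structure Sec14Geometry (k : Type) [Field k] [NumberField k] (S : Scheme.{u}) (Mspl : Type u) [Groupoid.{v} Mspl] where
  /-- ⟨CARRIER⟩ `j_𝔞` on objects: `E ↦ (𝔞 ⊗_ℤ E, ι, λ)`. -/
  jObj : ClassGroup (𝓞 k) → EllCurveOver S → Mspl
  /-- ⟨CARRIER⟩ `j_𝔞` on isomorphisms of elliptic curves. -/
  jMap : ∀ (𝔞 : ClassGroup (𝓞 k)) {E E' : EllCurveOver S}, EllIso E E' → (jObj 𝔞 E ⟶ jObj 𝔞 E')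
  /-- ⟨CARRIER LAW⟩ `j_𝔞(id) = id`. -/
  jMap_id : ∀ (𝔞 : ClassGroup (𝓞 k)) (E : EllCurveOver S) (e : EllIso E E), e.1 = Iso.refl _ → jMap 𝔞 e = 𝟙 _
  /-- ⟨CARRIER LAW⟩ `j_𝔞(e' ∘ e) = j_𝔞(e') ∘ j_𝔞(e)`. -/
  jMap_comp : ∀ (𝔞 : ClassGroup (𝓞 k)) {E E' E'' : EllCurveOver S} (e : EllIso E E') (e' : EllIso E' E'')
    (e'' : EllIso E E''), e''.1 = e.1 ≪≫ e'.1 → jMap 𝔞 e'' = jMap 𝔞 e ≫ jMap 𝔞 e'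
  /-- ⟨CARRIER⟩ «the `2`-adic Tate module has type II» (Prop. 14.4 (iii), Rem. 14.3) for an object of `M^{spl}(1,1)*(S)`. PLACEHOLDER. -/
  IsTypeII : Mspl → Prop

/-- **[KR2013, Proposition 14.4] AS PRINTED** (§14, arXiv v2 p. 53), for the consumer's `S`-points datum `G` (an `O_k`-scheme `S`, READING:
«isomorphism of stacks» = equivalence of the groupoids of `S`-points for every `S`, naturally in `S`; typed one `S` at a time, the
naturality RECORDED):

«(i) The morphism `j_𝔞` of (14.1) has image contained in `M^{spl}(1,1)*`. (ii) If `2 ∤ Δ`, the morphisms `j_𝔞` induce an isomorphism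
`∐_{[𝔞] ∈ C(k)} j_𝔞 : ∐_{[𝔞] ∈ C(k)} 𝓔 ⥲ M^{spl}(1,1)*`. (iii) If `2 ∣ Δ`, then, over `Spec O_k[½]`, the morphisms `j_𝔞` induce an isomorphism
`∐_{[𝔞] ∈ C(k)} j_𝔞 : ∐_{[𝔞] ∈ C(k)} 𝓔[½] ⥲ M^{spl,II}(1,1)*[½]`, where `M^{spl,II}(1,1)*[½]` denotes the locus in `M^{spl}(1,1)*[½]` where the
`2`-adic Tate module has type II.»

TYPED: (i) is the typing of `G.jObj`; (ii) `2 ∤ Δ` ⟹ `∐_𝔞 j_𝔞` is an EQUIVALENCE from the REAL groupoid `∐_{[𝔞] ∈ C(k)} 𝓔(S)` (objects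
`ClassGroup (𝓞 k) × EllCurveOver S`, morphisms `EllIso` within a summand): each `j_𝔞` fully faithful, distinct summands land in
non-isomorphic objects, every object of `M^{spl}(1,1)*(S)` is isomorphic to some `j_𝔞(E)`; (iii) `2 ∣ Δ` and `2` invertible on `S`
(REAL: `2 ∈ Γ(S, 𝒪_S)^×`) ⟹ the same onto the full subgroupoid of type-II objects.  A consumer takes `(h : KR2013_14_4 G)`. NO PROOF.
[cite: KudlaRapoport2013, §14 Prop. 14.4 (arXiv v2 p. 53)] -/
def KR2013_14_4 {Mspl : Type u} [Groupoid.{v} Mspl] (G : Sec14Geometry k S Mspl) : Prop :=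
  (¬ 2 ∣ absDisc k →
    (∀ (𝔞 : ClassGroup (𝓞 k)) (E E' : EllCurveOver S), Function.Bijective (G.jMap 𝔞 (E := E) (E' := E'))) ∧
    (∀ (𝔞 𝔟 : ClassGroup (𝓞 k)) (E E' : EllCurveOver S), 𝔞 ≠ 𝔟 → IsEmpty (G.jObj 𝔞 E ⟶ G.jObj 𝔟 E')) ∧
    (∀ X : Mspl, ∃ (𝔞 : ClassGroup (𝓞 k)) (E : EllCurveOver S), Nonempty (G.jObj 𝔞 E ⟶ X))) ∧
  (2 ∣ absDisc k → IsUnit ((2 : ℕ) : Γ(S, ⊤)) →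
    (∀ (𝔞 : ClassGroup (𝓞 k)) (E : EllCurveOver S), G.IsTypeII (G.jObj 𝔞 E)) ∧
    (∀ (𝔞 : ClassGroup (𝓞 k)) (E E' : EllCurveOver S), Function.Bijective (G.jMap 𝔞 (E := E) (E' := E'))) ∧
    (∀ (𝔞 𝔟 : ClassGroup (𝓞 k)) (E E' : EllCurveOver S), 𝔞 ≠ 𝔟 → IsEmpty (G.jObj 𝔞 E ⟶ G.jObj 𝔟 E')) ∧
    (∀ X : Mspl, G.IsTypeII X → ∃ (𝔞 : ClassGroup (𝓞 k)) (E : EllCurveOver S), Nonempty (G.jObj 𝔞 E ⟶ X)))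

/-! ## p. 54: `Z*(m)`, `T(m)`, `T(m)_{Δ,𝔞}` and Proposition 14.5, Lemma 14.6 -/

/-- ⟨CARRIER⟩ **The Hecke-correspondence data of p. 54 on `S`-points**, for the consumer's `O_k`-scheme `S`: `M0` = objects of `M₀(S)`
with the REAL underlying elliptic curve `i₀ : M₀ → 𝓔`, «`(E₀, ι₀) ↦ E₀`»; `tIdeal 𝔞` = «`t_𝔞 : M₀ → M₀` sends `E₀` to `𝔞⁻¹ ⊗_{O_k} E₀`»
(so `i_𝔞 = i₀ ∘ t_𝔞`); `TmObj m` = objects of «`T(m)` … triples `(E, E', ψ)` … `ψ : E → E'` is an `m`-isogeny» with REAL `s`, `t`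
(«sending `(E, E', ψ)` to `E` (resp. `E'`)»); `ZstarObj m` = objects of the special cycle «`Z*(m) → M*`» (collections
`(A, ι, λ, E₀, ι₀, λ₀; x)`, `x ∈ Hom_S((E₀, ι₀), (A, ι)) ⊗ ℚ` an `O_k`-linear quasi-homomorphism with `x* = λ₀⁻¹ ∘ x^∨ ∘ λ` integral and
`h(x, x) = x* ∘ x = m`) with its projections to `Mspl` and `M₀`; and, for Prop. 14.5, the two FIBRE types over a point `(E, E₀)` of
`𝓔 × M₀` up to isomorphism in the fibre: of `(j_𝔞 × 1)* Z*(m)` and of `T(m)_{Δ,𝔞} = (𝓔 × M₀) ×_{1 × i_𝔞, 𝓔 × 𝓔, (s,t)} T(m)`.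
PLACEHOLDERS except the `EllCurveOver`-valued fields. [cite: KudlaRapoport2013, §14 (arXiv v2 p. 54)] -/
structure HeckeData (k : Type) [Field k] [NumberField k] (S : Scheme.{u}) (Mspl : Type u) where
  /-- ⟨CARRIER⟩ objects of `M₀(S)`. -/
  M0 : Type u
  /-- «`i₀ : M₀ → 𝓔`, `(E₀, ι₀) ↦ E₀`» (REAL values). -/
  i₀ : M0 → EllCurveOver S
  /-- ⟨CARRIER⟩ «`t_𝔞 : M₀ → M₀` sends `E₀` to `𝔞⁻¹ ⊗_{O_k} E₀`» on objects. -/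
  tIdeal : ClassGroup (𝓞 k) → M0 → M0
  /-- ⟨CARRIER⟩ objects `(E, E', ψ)` of `T(m)(S)`. -/
  TmObj : ℕ → Type u
  /-- «`s : T(m) → 𝓔`», `(E, E', ψ) ↦ E` (REAL values). -/
  s : ∀ {m : ℕ}, TmObj m → EllCurveOver S
  /-- «`t : T(m) → 𝓔`», `(E, E', ψ) ↦ E'` (REAL values). -/
  t : ∀ {m : ℕ}, TmObj m → EllCurveOver S
  /-- ⟨CARRIER⟩ objects of `Z*(m)(S)`. -/
  ZstarObj : ℕ → Type u
  /-- ⟨CARRIER⟩ the projection `Z*(m) → M^{spl}(1,1)*`. -/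
  zToM : ∀ {m : ℕ}, ZstarObj m → Mspl
  /-- ⟨CARRIER⟩ the projection `Z*(m) → M₀`. -/
  zToM0 : ∀ {m : ℕ}, ZstarObj m → M0
  /-- ⟨CARRIER⟩ isomorphism classes of the fibre of `(j_𝔞 × 1)* Z*(m)` over `(E, E₀) ∈ (𝓔 × M₀)(S)`. -/
  FibreZ : ClassGroup (𝓞 k) → ℕ → EllCurveOver S → M0 → Type u
  /-- ⟨CARRIER⟩ isomorphism classes of the fibre of `T(m)_{Δ,𝔞}` over `(E, E₀)`, i.e. of `m`-isogenies `E → i_𝔞(E₀) = 𝔞⁻¹ ⊗ E₀`. -/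
  FibreT : ClassGroup (𝓞 k) → ℕ → EllCurveOver S → M0 → Type u

/-- **[KR2013, Proposition 14.5] SHAPE** (§14, arXiv v2 p. 54), for the consumer's Hecke data `H`: «There is a natural isomorphism
`(j_𝔞 × 1)* Z*(m) ⥲ T(m)_{Δ,𝔞}` over `𝓔 × M₀`.»  TYPED as the SHAPE (both sides are carriers): for every `[𝔞]`, `m ≥ 1` and every point
`(E, E₀)` of `𝓔 × M₀` over `S`, a bijection between the fibre classes `FibreZ 𝔞 m E E₀` and `FibreT 𝔞 m E E₀`.  Not a fact; it records
where the printed isomorphism sits. [cite: KudlaRapoport2013, §14 Prop. 14.5 (arXiv v2 p. 54)] -/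
def KR2013_14_5 {Mspl : Type u} (H : HeckeData k S Mspl) : Prop :=
  ∀ (𝔞 : ClassGroup (𝓞 k)) (m : ℕ), 1 ≤ m → ∀ (E : EllCurveOver S) (x₀ : H.M0),
    Nonempty (H.FibreZ 𝔞 m E x₀ ≃ H.FibreT 𝔞 m E x₀)

/-- ⟨CARRIER⟩ **The data of Lemma 14.6** (p. 54): the two Hom-sets «`Hom_{O_k}(𝔞 ⊗_ℤ E, E₀)`» and «`Hom_ℤ(E, 𝔞⁻¹ ⊗_{O_k} E₀)`», the
natural isomorphism (14.2) «arising from the Serre construction», the hermitian form «`h(y, y) = y ∘ y*`» (valued in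
`End_{O_k}(E₀) = O_k`, here in `ℤ` as printed: `h(y,y) = deg y₀`) and the degree of an isogeny.  PLACEHOLDERS.
[cite: KudlaRapoport2013, §14 Lem. 14.6 (arXiv v2 p. 54)] -/
structure SerreAdjData : Type (u + 1) where
  /-- ⟨CARRIER⟩ `Hom_{O_k}(𝔞 ⊗_ℤ E, E₀)`. -/
  HomOK : Type u
  /-- ⟨CARRIER⟩ `Hom_ℤ(E, 𝔞⁻¹ ⊗_{O_k} E₀)`. -/
  HomZ : Type u
  /-- ⟨CARRIER⟩ the natural isomorphism (14.2). -/
  adj : HomOK ≃ HomZ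
  /-- ⟨CARRIER⟩ `y ↦ h(y, y) = y ∘ y*` (an integer). -/
  hSelf : HomOK → ℤ
  /-- ⟨CARRIER⟩ `y₀ ↦ deg(y₀)`. -/
  deg : HomZ → ℕ

/-- **[KR2013, Lemma 14.6] SHAPE** (§14, arXiv v2 p. 54): «If `y ∈ Hom_{O_k}(𝔞 ⊗_ℤ E, E₀)` and `y₀ ∈ Hom_ℤ(E, 𝔞⁻¹ ⊗_{O_k} E₀)` correspond
under (14.2), then `h(y, y) = y ∘ y* = deg(y₀)`.»  TYPED on the consumer's ⟨CARRIER⟩ `SerreAdjData` (both sides carriers ⇒ SHAPE).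
[cite: KudlaRapoport2013, §14 Lem. 14.6 (arXiv v2 p. 54)] -/
def KR2013_14_6 (X : SerreAdjData.{u}) : Prop :=
  ∀ y : X.HomOK, X.hSelf y = (X.deg (X.adj y) : ℤ)

/-! ## pp. 55–56: `Γ₀(N)`-level and Proposition 14.7 -/

/-- The conjugate `𝔫^σ` of an ideal of `O_k` (`σ = conj ℚ k` restricted to `O_k`, Mathlib `RingOfIntegers.mapRingEquiv`).
[cite: KudlaRapoport2013, §14 (arXiv v2 p. 56)] -/
def conjIdeal (𝔫 : Ideal (𝓞 k)) : Ideal (𝓞 k) :=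
  𝔫.map (NumberField.RingOfIntegers.mapRingEquiv ((conj ℚ k : k ≃ₐ[ℚ] k) : k ≃+* k))

/-- «all primes dividing `N` split in `k`» (p. 56): the rational prime `p` splits in `O_k`, `p O_k = 𝔭 𝔭^σ` with `𝔭 ≠ 𝔭^σ` prime.
[cite: KudlaRapoport2013, §14 (arXiv v2 p. 56)] -/
def IsSplitPrime (k : Type) [Field k] [NumberField k] [IsTotallyComplex k] [Algebra.IsQuadraticExtension ℚ k] (p : ℕ) : Prop :=
  ∃ 𝔭 : Ideal (𝓞 k), 𝔭.IsPrime ∧ 𝔭 ≠ conjIdeal 𝔭 ∧ Ideal.span {((p : ℤ) : 𝓞 k)} = 𝔭 * conjIdeal 𝔭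

/-- **The hypothesis on `(N, 𝔫)` of p. 56** (REAL): «Finally, as in [14], we make the assumption that all primes dividing `N` split in `k`
and choose an integral ideal `𝔫` with `N(𝔫) = N`» (`N` «a positive integer», p. 55; Cor. 14.9: «the primitive ideal `𝔫` of norm `N`»,
typed as `𝔫 + 𝔫^σ = O_k`). [cite: KudlaRapoport2013, §14 (arXiv v2 pp. 55–56)] -/
def IsHeegnerLevel (N : ℕ) (𝔫 : Ideal (𝓞 k)) : Prop :=
  0 < N ∧ (∀ p : ℕ, p.Prime → p ∣ N → IsSplitPrime k p) ∧ Ideal.absNorm 𝔫 = N ∧ 𝔫 ⊔ conjIdeal 𝔫 = ⊤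

/-- ⟨CARRIER⟩ **The `Γ₀(N)`-level data of pp. 55–56 on `S`-points** (base `S` over `Spec O_k[N⁻¹]`): objects of «`𝓔₀(N)` … pairs of
elliptic curves `(E, E′, φ)` with a cyclic `N`-isogeny `φ`» with REAL source∕target curves; `M0`, `i_{0,𝔫} : M₀ → 𝓔₀(N)`,
«`E₀ ↦ (E₀ → E₀/E₀[𝔫])`», its twist `i_{𝔞,𝔫} = i_{0,𝔫} ∘ t_𝔞`; objects of «`T(m)₀(N)` … collections `(E, E′, φ, E″, ψ)` … `ψ : E → E″` an
isogeny of degree `m` such that `ker(ψ) ∩ ker(φ)` is trivial» with source∕target in `𝓔₀(N)`; objects of «`Z**(m) → M** = M^{spl}(1,1)*₀(N) × M₀`»;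
and the two FIBRE-class types over a point of `𝓔₀(N) × M₀`: of `(j_{𝔞,N} × 1)*(Z**(m))` and of `T(m)₀(N)_{Δ,𝔞,𝔫}` (the fibre product along
`1 × i_{𝔞,𝔫}` and `(s, t)`).  PLACEHOLDERS except the `EllCurveOver`-valued fields. [cite: KudlaRapoport2013, §14 (arXiv v2 pp. 55–56)] -/
structure LevelHeckeData (k : Type) [Field k] [NumberField k] (S : Scheme.{u}) where
  /-- ⟨CARRIER⟩ objects `(E, E′, φ)` of `𝓔₀(N)(S)`, for each `N`. -/
  E0N : ℕ → Type u
  /-- the source curve `E` of `(E, E′, φ)` (REAL values). -/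
  src : ∀ {N : ℕ}, E0N N → EllCurveOver S
  /-- the target curve `E′` of `(E, E′, φ)` (REAL values). -/
  tgt : ∀ {N : ℕ}, E0N N → EllCurveOver S
  /-- ⟨CARRIER⟩ objects of `M₀(S)`. -/
  M0 : Type u
  /-- ⟨CARRIER⟩ «`i_{𝔞,𝔫} = i_{0,𝔫} ∘ t_𝔞 : M₀ → 𝓔₀(N)`», `E₀ ↦ (𝔞⁻¹ ⊗ E₀ → 𝔞⁻¹ ⊗ E₀ / (𝔞⁻¹ ⊗ E₀)[𝔫])`, for `N(𝔫) = N`. -/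
  iTwist : ∀ {N : ℕ}, ClassGroup (𝓞 k) → Ideal (𝓞 k) → M0 → E0N N
  /-- ⟨CARRIER⟩ isomorphism classes of the fibre of `(j_{𝔞,N} × 1)*(Z**(m))` over a point `(ξ, E₀)` of `𝓔₀(N) × M₀`. -/
  FibreZZ : ∀ {N : ℕ}, ClassGroup (𝓞 k) → ℕ → E0N N → M0 → Type u
  /-- ⟨CARRIER⟩ isomorphism classes of the fibre of `T(m)₀(N)_{Δ,𝔞,𝔫}` over `(ξ, E₀)`: objects `(ξ, E″, ψ)` of `T(m)₀(N)` with source `ξ`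
  and target `i_{𝔞,𝔫}(E₀)`. -/
  FibreT0 : ∀ {N : ℕ}, ClassGroup (𝓞 k) → Ideal (𝓞 k) → ℕ → E0N N → M0 → Type u

/-- **[KR2013, Proposition 14.7] SHAPE** (§14, arXiv v2 p. 56), for the consumer's level data `H`, an integer `N` and an ideal `𝔫` under
`IsHeegnerLevel N 𝔫` (REAL hypothesis): «There is a natural isomorphism `(j_{𝔞,N} × 1)*(Z**(m)) ⥲ ∐_𝔫 T(m)₀(N)_{Δ,𝔞,𝔫}` over `𝓔₀(N) × M₀`, where
`T(m)₀(N)_{Δ,𝔞,𝔫} → T(m)₀(N)`, `𝓔₀(N) × M₀ → 𝓔₀(N) × 𝓔₀(N)` (`1 × i_{𝔞,𝔫}`, `(s,t)`) is the fiber product.»  TYPED as the SHAPE (carriers on both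
sides): fibrewise over each point `(ξ, E₀)`, a bijection between `FibreZZ 𝔞 m ξ E₀` and the disjoint union over the integral ideals `𝔫′`
of norm `N` (all primes of `N` split) of `FibreT0 𝔞 𝔫′ m ξ E₀`.  Not a fact. [cite: KudlaRapoport2013, §14 Prop. 14.7 (arXiv v2 p. 56)] -/
def KR2013_14_7 (H : LevelHeckeData k S) (N : ℕ) : Prop :=
  (∃ 𝔫 : Ideal (𝓞 k), IsHeegnerLevel N 𝔫) →
    ∀ (𝔞 : ClassGroup (𝓞 k)) (m : ℕ), 1 ≤ m → ∀ (ξ : H.E0N N) (x₀ : H.M0),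
      Nonempty (H.FibreZZ 𝔞 m ξ x₀ ≃ Σ 𝔫 : {𝔫 : Ideal (𝓞 k) // IsHeegnerLevel N 𝔫}, H.FibreT0 𝔞 𝔫.1 m ξ x₀)

/-! ## pp. 57–58: Proposition 14.10 (the relation among the `M(t; 1,1)*` for varying `t`) -/

/-- ⟨CARRIER⟩ **The data of Proposition 14.10** for the consumer's models: the morphism «`M(t;1,1)^{*,p} → M(t;1,1)*`» and
«`φ : M(t;1,1)^{*,p} → M(t′;1,1)*`» with the printed properties as `Prop` PLACEHOLDER fields (no DM-stack vocabulary in Lean: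
étale Galois covering of degree 2, proper, finite of degree `p+1` outside the fibres over `p`, contracts lines in the special fibre at `p`).
[cite: KudlaRapoport2013, §14 Prop. 14.10 (arXiv v2 p. 57)] -/
structure DegenerationData : Type where
  /-- «an étale Galois covering of degree 2 `M(t;1,1)^{*,p} → M(t;1,1)*`». PLACEHOLDER. -/
  etaleGaloisDoubleCover : Prop
  /-- «a proper morphism `φ : M(t;1,1)^{*,p} → M(t′;1,1)*`». PLACEHOLDER. -/
  properPhi : Prop
  /-- «finite of degree `p+1` outside the fibers over `p`». PLACEHOLDER. -/
  finiteDegreeOffP : ℕ → Prop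
  /-- «contracts some lines in the special fiber of `M(t;1,1)^{*,p}` at `p`». PLACEHOLDER. -/
  contractsLinesAt : ℕ → Prop

/-- **[KR2013, Proposition 14.10] AS PRINTED** (§14, arXiv v2 p. 57), for a type function `t` on the prime divisors of `Δ` (REAL, as in §13.1),
a prime `p` and the consumer's ⟨CARRIER⟩ models `X` of `M(t;1,1)*`, `M(t;1,1)^{*,p}`, `M(t′;1,1)*`: «Suppose that `t` is given and that
`t(p) = 0` for some prime `p ≠ 2` with `p ∣ Δ`. Define `t′` by `t′(p′) = t(p′)` for `p ≠ p′` and `t′(p) = 2`. Then there exists an etale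
Galois covering of degree 2 `M(t;1,1)^{*,p} → M(t;1,1)*`, equipped with a proper morphism `φ : M(t;1,1)^{*,p} → M(t′;1,1)*`, which is finite
of degree `p+1` outside the fibers over `p` and which contracts some lines in the special fiber of `M(t;1,1)^{*,p}` at `p`, (cf. Remark 14.11
below).»  TYPED: the REAL hypotheses on `(t, p)` (and `t′ := Function.update t p 2`, for the record) imply the PLACEHOLDER conclusions of `X`.
**Remark 14.11** (Dieudonné-module description of the fibres of positive dimension — supersingular if `inv_p(V_p) = 1`, superspecial if
`−1`; regularity by Prop. 13.1; étaleness by EGA IV 18.10.16; `φ` = blow-up followed by a finite morphism; the variant for a set `S` of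
such primes) is RECORDED, not typed.  A consumer takes `(h : KR2013_14_10 t p X)`. NO PROOF. [cite: KudlaRapoport2013, §14 Prop. 14.10 (arXiv v2 p. 57)] -/
def KR2013_14_10 (t : ℕ → ℕ) (p : ℕ) (X : DegenerationData) : Prop :=
  (∀ q : ℕ, q.Prime → q ∣ absDisc k → Even (t q) ∧ t q ≤ 2) →
    p.Prime → p ≠ 2 → p ∣ absDisc k → t p = 0 →
      X.etaleGaloisDoubleCover ∧ X.properPhi ∧ X.finiteDegreeOffP p ∧ X.contractsLinesAt p

end Geometry

end Literature.AlgebraicGeometry.ShimuraVarieties.KudlaRapoport2013.Sec14CaseNTwo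

end
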